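import Literature.AnabelianGeometry.AbsoluteAnabelian.AbsTopIThm26GeomDichotomy
import HarnessLib

/-!
# The «projectivity route» to «`Δ ⊆ Π` characteristic» at `Σ = 𝔓𝔯𝔦𝔪𝔢𝔰`: a centralising subgroup of `Π`
# turns a non-geometric isomorphism into a COMMUTING PAIR of subgroups of `Δ` (generic, proof-only)

S. Mochizuki, *Topics in Absolute Anabelian Geometry I: Generalities*, J. Math. Sci. Univ. Tokyo **19**
(2012) [AbsTopI], Thm 2.6 (iv)/(v) p. 22 [cite: MochizukiAbsTopI2012, Thm 2.6 (v) p.22]; [AbsAnab] Lemma 1.3.8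
p. 18 [cite: MochizukiAbsAnab2004, Lemma 1.3.8 p.18]; slimness [AbsAnab] Def 0.1 p. 4
[cite: MochizukiAbsAnab2004, Def 0.1 (ii) p.4].

Cell `abc-iut`, seat abc-iut-w6-d055 (gen 5), row «MCHAR-VIA-PROJECTIVITY» (abc-iut-L6-lead §F v1.19bt (2), joint with
abc-iut-L2-lead R565; K-L6 custody binder (H1) `hΔX` at the [EtTh] Tate model, abc-iut-w4-d043's reduction
`hΔX ⟺ MChar` p466815, abc-iut-f-142's desk note 18:11:29Z).  Sequel of this seat's `AbsTopIThm26GeomDichotomy`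
(the ELASTICITY DICHOTOMY: `PreservesGeom φ` or both cross-images open, and then `φ(Δ_E) ∩ Δ_F ≠ 1` for
`δ¹`-balanced `Δ_E`).  PROOF-ONLY, GENERIC over the tree's [AbsTopI] vocabulary (`FundamentalExtension`, `MLFBase`,
`PreservesGeom`, `IsSlimGroup`): NO model plumbing, no definition, no named fact, nothing restated.

THE OBSERVATION.  At the Tate model the arithmetic group `Π̂ = F′ ⋊ G_{ℚ_p}` carries the LARGE subgroup
`A := 1 ⋊ I_χ` (`I_χ = Ker κ_p ∩ Ker χ`, acting trivially on `F̂₂`) which CENTRALISES `Δ̂ = F′` and meets it trivially.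
This file proves, for ANY extensions `E`, `F` with MLF base data, topologically finitely generated `Δ_E`, `Δ_F`, SLIM
`G_E`, an isomorphism `φ : Π_E ⥲ Π_F`, and ANY subgroup `A ≤ Π_F` centralising `Δ_F`:

* `MLFBase.inf_comap_le_map_geom_of_le_centralizer` — EITHER `PreservesGeom φ`, OR every `a ∈ A` lying over the
  image `N_G := aug_F(φ(Δ_E))` already lies in `φ(Δ_E)`: `A ∩ aug_F⁻¹(N_G) ⊆ φ(Δ_E)`.  (Elementwise: `a = d·n` with
  `d ∈ Δ_F`, `n ∈ φ(Δ_E)`; since `a` centralises `Δ_F` and `φ(Δ_E)` is normal, `[d⁻¹, x] ∈ φ(Δ_E)` for all `x ∈ Δ_F`,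
  so `aug_E(φ⁻¹ d)` centralises the OPEN subgroup `aug_E(φ⁻¹(Δ_F))` of `G_E` (open by the dichotomy), hence is
  trivial by slimness of `G_E`, i.e. `d ∈ φ(Δ_E)`.)
* `MLFBase.preservesGeom_or_exists_commuting_pair` — the packaged consequence inside `Δ_E`: EITHER
  `PreservesGeom φ`, OR there are subgroups `R₀, S ≤ Δ_E` with `R₀ = φ⁻¹(φ(Δ_E) ∩ Δ_F)` closed, normal in `Π_E`
  and NON-TRIVIAL (given `Δ_E` `δ¹`-balanced at one `ℓ ≠ p`, by `map_geom_inf_geom_ne_bot_of_isOpen`),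
  `S = φ⁻¹(A ∩ aug_F⁻¹(N_G))` NON-TRIVIAL (given that `aug_F(A)` meets every open subgroup of `G_F`), `R₀` and `S`
  COMMUTE elementwise, and `R₀ ∩ S ⊆ φ⁻¹(A ∩ Δ_F)` (`= 1` when `A ∩ Δ_F = 1`).

So for such `(F, A)` the whole residual of «`Δ ⊆ Π` characteristic» is ONE property of the topological group
`Δ_E` alone: «a non-trivial closed normal subgroup of `Δ_E` has no non-trivial commuting partner meeting it
trivially» — for `Δ_E` free profinite of finite rank `≥ 2` a CLASSICAL fact (Ribes–Zalesskii *Profinite Groups*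
Thm 8.7.1 with §7.6–7.7, Serre *Cohomologie galoisienne* I §3.3/§4.1), to be typed BY NAME by the row's part (i).
HONEST SCOPE: group theory over typed predicates; NOT a verdict on (H1) at any model; nothing here bears on
[IUTchIII] Cor. 3.12; desk ≠ kernel; typed ≠ proved elsewhere.
-/

noncomputable section

open Topology Field
open Literature.AlgebraicGeometry.Frobenioids (IsSlimGroup)

namespace Literature.AnabelianGeometry.AbsoluteAnabelian

namespace FundamentalExtension

variable {E F : FundamentalExtension.{0}}

/-- **The centralising subgroup lies in the exotic image.**  For extensions `E`, `F` with MLF base data,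
topologically finitely generated `Δ_E`, `Δ_F`, SLIM `G_E`, an isomorphism `φ : Π_E ⥲ Π_F` and a subgroup
`A ≤ Π_F` centralising `Δ_F`: either `PreservesGeom φ`, or `A ∩ aug_F⁻¹(aug_F(φ(Δ_E))) ⊆ φ(Δ_E)`.
[cite: MochizukiAbsTopI2012, Thm 2.6 (v) p.22] -/
theorem MLFBase.inf_comap_le_map_geom_of_le_centralizer (BE : E.MLFBase) (BF : F.MLFBase)
    (hΔE : IsTopologicallyFinitelyGenerated E.geom) (hΔF : IsTopologicallyFinitelyGenerated F.geom)
    (hslim : IsSlimGroup E.gal) (φ : E.arith ≃ₜ* F.arith) (A : Subgroup F.arith)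
    (hA : A ≤ Subgroup.centralizer (F.geom : Set F.arith)) :
    PreservesGeom φ ∨
      A ⊓ ((E.geom.map φ.toMulEquiv.toMonoidHom).map F.aug.toMonoidHom).comap F.aug.toMonoidHom ≤
        E.geom.map φ.toMulEquiv.toMonoidHom := by
  rcases MLFBase.preservesGeom_or_isOpen BE BF hΔE hΔF φ with hP | ⟨-, hopen'⟩
  · exact Or.inl hP
  right
  set N : Subgroup F.arith := E.geom.map φ.toMulEquiv.toMonoidHom with hNdef
  have hNn : N.Normal := E.normal_geom.map φ.toMulEquiv.toMonoidHom φ.surjective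
  rintro a ⟨haA, haW⟩
  obtain ⟨n, hnN, hna⟩ := (Subgroup.mem_comap.mp haW)
  -- `a` commutes with every element of `Δ_F`
  have hac : ∀ x ∈ F.geom, x * a = a * x := fun x hx => (Subgroup.mem_centralizer_iff.mp (hA haA)) x hx
  -- the commutators `[(a n⁻¹)⁻¹, x]`, `x ∈ Δ_F`, lie in `N`
  have hcomm : ∀ x ∈ F.geom, (a * n⁻¹)⁻¹ * x * (a * n⁻¹) * x⁻¹ ∈ N := by
    intro x hx
    have hax : a⁻¹ * (x * a) = x := by rw [hac x hx, ← mul_assoc, inv_mul_cancel, one_mul]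
    have key : (a * n⁻¹)⁻¹ * x * (a * n⁻¹) * x⁻¹ = n * (x * n⁻¹ * x⁻¹) := by
      calc (a * n⁻¹)⁻¹ * x * (a * n⁻¹) * x⁻¹ = n * (a⁻¹ * (x * a)) * n⁻¹ * x⁻¹ := by group
        _ = n * x * n⁻¹ * x⁻¹ := by rw [hax]
        _ = n * (x * n⁻¹ * x⁻¹) := by group
    rw [key]
    exact N.mul_mem hnN (hNn.conj_mem _ (N.inv_mem hnN) x)
  -- abbreviate `d := a n⁻¹ ∈ Δ_F`
  obtain ⟨d, hd⟩ : ∃ d : F.arith, a * n⁻¹ = d := ⟨_, rfl⟩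
  rw [hd] at hcomm
  -- hence `aug_E(φ⁻¹ d)` centralises the open subgroup `aug_E(φ⁻¹(Δ_F))` of `G_E`
  have hg : E.aug (φ.symm d) ∈
      Subgroup.centralizer (((F.geom.map φ.symm.toMulEquiv.toMonoidHom).map E.aug.toMonoidHom :
        Subgroup E.gal) : Set E.gal) := by
    rw [Subgroup.mem_centralizer_iff]
    rintro _ ⟨y, ⟨x, hx, rfl⟩, rfl⟩
    change E.aug (φ.symm x) * E.aug (φ.symm d) = E.aug (φ.symm d) * E.aug (φ.symm x)
    -- the commutator `[d⁻¹, x] ∈ N = φ(Δ_E)` maps to `1` under `aug_E ∘ φ⁻¹`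
    obtain ⟨e, he, hec⟩ := hcomm x hx
    have h0 : E.aug (φ.symm (d⁻¹ * x * d * x⁻¹)) = 1 := by
      have : φ.symm (d⁻¹ * x * d * x⁻¹) = e := by
        rw [← hec]
        exact φ.symm_apply_apply e
      rw [this]
      exact E.mem_geom.mp he
    simp only [map_mul, map_inv] at h0
    have h2 : (E.aug (φ.symm d))⁻¹ * E.aug (φ.symm x) * E.aug (φ.symm d) = E.aug (φ.symm x) :=
      mul_inv_eq_one.mp h0
    calc E.aug (φ.symm x) * E.aug (φ.symm d)
        = E.aug (φ.symm d) * ((E.aug (φ.symm d))⁻¹ * E.aug (φ.symm x) * E.aug (φ.symm d)) := by group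
      _ = E.aug (φ.symm d) * E.aug (φ.symm x) := by rw [h2]
  -- slimness of `G_E`: that centraliser is trivial
  have hone : E.aug (φ.symm d) = 1 := by
    rw [hslim.centralizer_eq_bot _ hopen'] at hg
    exact Subgroup.mem_bot.mp hg
  -- so `d ∈ φ(Δ_E)`, hence `a = d n ∈ φ(Δ_E)`
  have hdN : d ∈ N := ⟨φ.symm d, E.mem_geom.mpr hone, φ.apply_symm_apply _⟩
  rw [mul_inv_eq_iff_eq_mul] at hd
  rw [hd]
  exact N.mul_mem hdN hnN

/-- **The commuting pair inside `Δ_E`.**  For extensions `E`, `F` with MLF base data `(p_E, k_E)`, `(p, k)`,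
topologically finitely generated `Δ_E`, `Δ_F`, SLIM `G_E`, `Δ_E` `δ¹`-balanced at a prime `ℓ ≠ p`
(`δ¹_ℓ(Δ_E) = δ¹_p(Δ_E)`, e.g. free profinite of finite rank), an isomorphism `φ : Π_E ⥲ Π_F`, and a subgroup
`A ≤ Π_F` centralising `Δ_F` whose image `aug_F(A)` meets every open subgroup of `G_F` non-trivially: EITHER
`PreservesGeom φ`, OR `Δ_E` contains the subgroups `R₀ := φ⁻¹(φ(Δ_E) ∩ Δ_F)` — closed, normal in `Π_E`,
NON-TRIVIAL — and `S := φ⁻¹(A ∩ aug_F⁻¹(aug_F φ(Δ_E)))` — NON-TRIVIAL — which COMMUTE elementwise and satisfy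
`R₀ ∩ S ⊆ φ⁻¹(A ∩ Δ_F)`.  (At the Tate model, `A = 1 ⋊ I_χ`, `A ∩ Δ̂ = 1`: a non-trivial closed normal subgroup of
the free profinite group `F′` with a non-trivial commuting partner meeting it trivially — excluded by classical
profinite group theory, the row's part (i).) [cite: MochizukiAbsTopI2012, Thm 2.6 (v) p.22] -/
theorem MLFBase.preservesGeom_or_exists_commuting_pair (BE : E.MLFBase) (BF : F.MLFBase)
    (hΔE : IsTopologicallyFinitelyGenerated E.geom) (hΔF : IsTopologicallyFinitelyGenerated F.geom)
    (hslim : IsSlimGroup E.gal) (φ : E.arith ≃ₜ* F.arith)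
    {ℓ : ℕ} [Fact ℓ.Prime] (hℓ : ℓ ≠ BF.p)
    (hbal : freeProlRank E.geom ℓ = @freeProlRank E.geom _ _ BF.p BF.instPrime)
    (A : Subgroup F.arith) (hA : A ≤ Subgroup.centralizer (F.geom : Set F.arith))
    (hAU : ∀ U : Subgroup F.gal, IsOpen (U : Set F.gal) → A.map F.aug.toMonoidHom ⊓ U ≠ ⊥) :
    PreservesGeom φ ∨
      ∃ R₀ S : Subgroup E.arith,
        R₀ = (E.geom.map φ.toMulEquiv.toMonoidHom ⊓ F.geom).map φ.symm.toMulEquiv.toMonoidHom ∧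
        S = (A ⊓ ((E.geom.map φ.toMulEquiv.toMonoidHom).map F.aug.toMonoidHom).comap
              F.aug.toMonoidHom).map φ.symm.toMulEquiv.toMonoidHom ∧
        R₀ ≤ E.geom ∧ S ≤ E.geom ∧ R₀ ≠ ⊥ ∧ S ≠ ⊥ ∧ R₀.Normal ∧ IsClosed (R₀ : Set E.arith) ∧
        (∀ r ∈ R₀, ∀ s ∈ S, r * s = s * r) ∧
        R₀ ⊓ S ≤ (A ⊓ F.geom).map φ.symm.toMulEquiv.toMonoidHom := by
  rcases MLFBase.inf_comap_le_map_geom_of_le_centralizer BE BF hΔE hΔF hslim φ A hA with hP | hAN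
  · exact Or.inl hP
  rcases MLFBase.preservesGeom_or_isOpen BE BF hΔE hΔF φ with hP | ⟨hopen, -⟩
  · exact Or.inl hP
  right
  set N : Subgroup F.arith := E.geom.map φ.toMulEquiv.toMonoidHom with hNdef
  set W : Subgroup F.arith := (N.map F.aug.toMonoidHom).comap F.aug.toMonoidHom with hWdef
  have hNn : N.Normal := E.normal_geom.map φ.toMulEquiv.toMonoidHom φ.surjective
  have hNc : IsClosed (N : Set F.arith) := by
    have : (N : Set F.arith) = φ '' (E.geom : Set E.arith) := by
      rw [hNdef, Subgroup.coe_map]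
      rfl
    rw [this]
    exact φ.toHomeomorph.isClosedMap _ E.isClosed_geom
  -- membership in images under `φ⁻¹`
  have hmem_symm : ∀ (H : Subgroup F.arith) (z : E.arith),
      z ∈ H.map φ.symm.toMulEquiv.toMonoidHom ↔ φ z ∈ H := by
    intro H z
    constructor
    · rintro ⟨y, hy, rfl⟩
      change φ (φ.symm y) ∈ H
      rw [φ.apply_symm_apply]
      exact hy
    · intro hz
      exact ⟨φ z, hz, φ.symm_apply_apply z⟩
  refine ⟨(N ⊓ F.geom).map φ.symm.toMulEquiv.toMonoidHom, (A ⊓ W).map φ.symm.toMulEquiv.toMonoidHom,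
    rfl, rfl, ?_, ?_, ?_, ?_, ?_, ?_, ?_, ?_⟩
  · -- `R₀ ≤ Δ_E`
    intro z hz
    obtain ⟨⟨e, he, hφe⟩, -⟩ := (hmem_symm _ z).mp hz
    have : e = z := φ.injective hφe
    rw [← this]
    exact he
  · -- `S ≤ Δ_E` (the centralising subgroup lies in the exotic image)
    intro z hz
    have hz' := hAN ((hmem_symm _ z).mp hz)
    obtain ⟨e, he, hφe⟩ := hz'
    have : e = z := φ.injective hφe
    rw [← this]
    exact he
  · -- `R₀ ≠ 1` (the `δ¹`-balance clause of the dichotomy file)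
    intro hbot
    apply MLFBase.map_geom_inf_geom_ne_bot_of_isOpen BF φ hopen hℓ hbal
    rw [← hNdef]
    refine (Subgroup.eq_bot_iff_forall _).mpr fun c hc => ?_
    have hz : φ.symm c ∈ (N ⊓ F.geom).map φ.symm.toMulEquiv.toMonoidHom := ⟨c, hc, rfl⟩
    rw [hbot] at hz
    have : φ.symm c = 1 := Subgroup.mem_bot.mp hz
    rw [← φ.apply_symm_apply c, this, map_one]
  · -- `S ≠ 1` (`aug_F(A)` meets the open `N_G`)
    intro hbot
    apply hAU (N.map F.aug.toMonoidHom) hopen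
    refine (Subgroup.eq_bot_iff_forall _).mpr fun u hu => ?_
    obtain ⟨⟨a, haA, rfl⟩, huN⟩ := hu
    have haW : a ∈ W := Subgroup.mem_comap.mpr huN
    have hz : φ.symm a ∈ (A ⊓ W).map φ.symm.toMulEquiv.toMonoidHom := ⟨a, ⟨haA, haW⟩, rfl⟩
    rw [hbot] at hz
    have ha1 : a = 1 := by
      have : φ.symm a = 1 := Subgroup.mem_bot.mp hz
      rw [← φ.apply_symm_apply a, this, map_one]
    rw [ha1, map_one]
  · -- `R₀` normal in `Π_E`
    haveI : N.Normal := hNn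
    haveI : (N ⊓ F.geom).Normal := Subgroup.normal_inf_normal N F.geom
    exact Subgroup.Normal.map this _ φ.symm.surjective
  · -- `R₀` closed
    have : (((N ⊓ F.geom).map φ.symm.toMulEquiv.toMonoidHom : Subgroup E.arith) : Set E.arith) =
        φ.symm '' ((N ⊓ F.geom : Subgroup F.arith) : Set F.arith) := by
      rw [Subgroup.coe_map]
      rfl
    rw [this]
    exact φ.symm.toHomeomorph.isClosedMap _ (by rw [Subgroup.coe_inf]; exact hNc.inter F.isClosed_geom)
  · -- `R₀` and `S` commute: `A` centralises `Δ_F ⊇ φ(R₀)`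
    intro r hr s hs
    obtain ⟨-, hrF⟩ := (hmem_symm _ r).mp hr
    obtain ⟨hsA, -⟩ := (hmem_symm _ s).mp hs
    have h := (Subgroup.mem_centralizer_iff.mp (hA hsA)) (φ r) hrF
    -- `φ r * φ s = φ s * φ r`; pull back along `φ`
    apply φ.injective
    rw [map_mul, map_mul]
    exact h
  · -- `R₀ ∩ S ⊆ φ⁻¹(A ∩ Δ_F)`
    rintro z ⟨hzR, hzS⟩
    obtain ⟨-, hzF⟩ := (hmem_symm _ z).mp hzR
    obtain ⟨hzA, -⟩ := (hmem_symm _ z).mp hzS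
    exact (hmem_symm _ z).mpr ⟨hzA, hzF⟩

end FundamentalExtension

end Literature.AnabelianGeometry.AbsoluteAnabelian

end
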